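import Literature.MathematicalPhysics.KineticTheory.HardSphereDLRBridge
import Literature.MathematicalPhysics.KineticTheory.HardSphereDLRCovariance
import Mathlib.Analysis.Calculus.SmoothSeries
import Mathlib.Analysis.Calculus.MeanValue
import HarnessLib

/-!
# The free finite-volume hard-sphere probabilities are uniformly Lipschitz in the activity

(topic MathematicalPhysics/KineticTheory; the general-dimension port — `EuclideanSpace ℝ ι`, namespace
`HardSphereDLR`, `ℝ³` in the comments standing for `ℝ^ι`, `1/(64σ³)` for `1/(8(2σ)^{#ι})` — of
`StatisticalMechanics/HardSphereFreeMeasureActivityDerivative.lean`: two auxiliary definitions (Janossy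
coefficients / series of an event, now for marks in `ℝ^ι`) and theorems; no new named facts; eighth file of
the general-`d` port needed for `HardSphereGibbsLowDensityUniqueness`.)

Fix the hard-sphere diameter `σ > 0`, a probability law `M` of the velocity marks and the
one-particle intensities `ν_z = z · Leb ⊗ M` (`z ≥ 0`).  For a bounded Borel window `Λ ⊆ ℝ³` the free
finite-volume hard-sphere distribution `γ^z_Λ := hsLocalSpec σ ν_z Λ ∅` gives to a measurable event `A`
the probability

  `γ^z_Λ(A) = Φ_{A ∩ HC}(z) / Φ_{HC}(z)`,  `Φ_S(z) = ∑ₖ zᵏ/k! · J_k(S)`,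
  `J_k(S) = ∫ 𝟙_S({x₁,…,x_k}|_Λ) d(Leb|_Λ ⊗ M)^{⊗k}`

(`hsLocalSpec_empty_apply_eq` of `DiluteHardSphereGasProofs`; Ruelle 1969 (2.10)–(2.12)).  The
`Φ_S` are entire power series in `z`; differentiating term by term and splitting off the first
thrown particle (`J_{k+1}(S) = ∫ J_k(S^a) dπ(a)` with `S^a = {c | c ∪ {a} ∈ S}`) gives Ruelle's
formula for the activity derivative of a finite-volume Gibbs probability as an integrated
covariance with the insertion of one particle,

  `d/dz γ^z_Λ(A) = ∫_{Λ × ℝ³} ( γ^z_Λ((A ∩ HC)^a) - γ^z_Λ(A) γ^z_Λ(HC^a) ) d(Leb ⊗ M)(a)`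

(`hasDerivWithinAt_hsLocalSpec_empty_toReal`).  For the vacancy event `V = {N(B°_σ(0) × ℝ³) = 0}`
and `a = (x, v)` not a point of the configuration, `(V ∩ HC)^a = V ∩ HC ∩ E_x` (if `‖x‖ ≥ σ`, else `∅`)
and `HC^a = HC ∩ E_x` with `E_x = {N(B°_σ(x) × ℝ³) = 0}`, so the integrand is the covariance of the
vacancy events of two balls, which by `abs_measureReal_vacant_inter_vacant_sub_le` (consistency +
Michelen–Perkins boundary decay) is at most `32 · 2^{-⌊‖x‖/σ⌋}` once `64 z σ³ ≤ 1`, an integrable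
function of `x ∈ ℝ³` independent of the volume `Λ = B(0,R)`.  Hence (mean value theorem)

  `|γ^z_{B(0,R)}(V) - γ^{z'}_{B(0,R)}(V)| ≤ L_σ |z - z'|`  for `0 ≤ z, z' ≤ 1/(64σ³)` and all `R`

(`abs_hsLocalSpec_empty_vacant_sub_le`), the finite-volume form of the Lipschitz continuity in the
activity of the contact (vacancy) probability of the low-activity hard-sphere state — Ruelle 1969,
§4.2, Thm 4.2.3 (analyticity of the correlation functions in `z` at low activity), here by the
DLR/disagreement route of Michelen–Perkins instead of the Kirkwood–Salsburg equations.

## References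

* D. Ruelle, *Statistical Mechanics: Rigorous Results*, Benjamin 1969, §1.2.1 (2.10)–(2.12), §4.2,
  Thm 4.2.3. [Ruelle1969]
* M. Michelen, W. Perkins, *Potential-weighted connective constants and uniqueness of Gibbs
  measures*, arXiv:2109.01094, Thm 25 and §5. [MichelenPerkins2021]
* G. Last, M. Penrose, *Lectures on the Poisson Process*, CUP 2017, Prop. 3.5, Thm 4.1.
  [LastPenrose2017]
-/

noncomputable section

open MeasureTheory ProbabilityTheory Set Filter Function Metric
open scoped ENNReal NNReal Topology

namespace Literature.MathematicalPhysics.KineticTheory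

namespace HardSphereDLR

open Literature.Analysis.FluidPDE (IsHardCore isHardCore_empty)
open Literature.Analysis.FunctionSpaces
open Literature.MathematicalPhysics.StatisticalMechanics (window mem_window measurableSet_window window_mono)

variable {ι : Type*} [Fintype ι]

/-- `PointConfig.ofFn` is measurable on phase-space tuples. [folklore] -/
theorem measurable_ofFn_phase (k : ℕ) :
    Measurable (PointConfig.ofFn : (Fin k → EuclideanSpace ℝ ι × EuclideanSpace ℝ ι) → PointConfig (EuclideanSpace ℝ ι × EuclideanSpace ℝ ι)) := by
  have h := (PointConfig.measurable_union_ofFn (E := EuclideanSpace ℝ ι × EuclideanSpace ℝ ι) k).comp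
    (measurable_id.prodMk (measurable_const (a := (∅ : PointConfig (EuclideanSpace ℝ ι × EuclideanSpace ℝ ι)))))
  simpa [Function.comp_def] using h

/-- The coefficients `J_k(S) ≤ |Λ|ᵏ` are finite. [folklore] -/
theorem lintegral_indicator_ofFn_le {M : Measure (EuclideanSpace ℝ ι)} [IsProbabilityMeasure M] {Λ : Set (EuclideanSpace ℝ ι)}
    (hb : Bornology.IsBounded Λ) (S : Set (PointConfig (EuclideanSpace ℝ ι × EuclideanSpace ℝ ι))) (k : ℕ) :
    ∫⁻ x, S.indicator (1 : PointConfig (EuclideanSpace ℝ ι × EuclideanSpace ℝ ι) → ℝ≥0∞) ((PointConfig.ofFn x).restrict (window Λ))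
        ∂(Measure.pi fun _ : Fin k => ((volume : Measure (EuclideanSpace ℝ ι)).restrict Λ).prod M) ≤ volume Λ ^ k := by
  haveI := isFiniteMeasure_restrict_prod hb M
  calc ∫⁻ x, S.indicator (1 : PointConfig (EuclideanSpace ℝ ι × EuclideanSpace ℝ ι) → ℝ≥0∞) ((PointConfig.ofFn x).restrict (window Λ))
        ∂(Measure.pi fun _ : Fin k => ((volume : Measure (EuclideanSpace ℝ ι)).restrict Λ).prod M)
      ≤ ∫⁻ _x, 1 ∂(Measure.pi fun _ : Fin k => ((volume : Measure (EuclideanSpace ℝ ι)).restrict Λ).prod M) :=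
        lintegral_mono fun x => indicator_apply_le' (fun _ => le_rfl) (fun _ => zero_le_one)
    _ = volume Λ ^ k := by
        rw [lintegral_one, Measure.pi_univ, Finset.prod_const, Finset.card_univ, Fintype.card_fin,
          ← univ_prod_univ, Measure.prod_prod, Measure.restrict_apply_univ, measure_univ, mul_one]

/-- **The free finite-volume hard-sphere probabilities are ratios of exponential-type series**:
`γ_Λ(∅)(A) = (∑ₖ zᵏ/k! J_k(HC))⁻¹ ∑ₖ zᵏ/k! J_k(A ∩ HC)`. [cite: Ruelle1969, §1.2.1 (2.10)–(2.12)] -/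
theorem hsLocalSpec_empty_apply_eq [Nonempty ι] {z : ℝ} (hz : 0 ≤ z) (M : Measure (EuclideanSpace ℝ ι)) [IsProbabilityMeasure M]
    (σ : ℝ) {Λ : Set (EuclideanSpace ℝ ι)} (hΛ : MeasurableSet Λ) (hb : Bornology.IsBounded Λ)
    {A : Set (PointConfig (EuclideanSpace ℝ ι × EuclideanSpace ℝ ι))} (hA : MeasurableSet A) :
    hsLocalSpec σ ((Real.toNNReal z) • ((volume : Measure (EuclideanSpace ℝ ι)).prod M)) Λ ∅ A =
      (∑' k : ℕ, ((k.factorial : ℝ≥0∞))⁻¹ * (ENNReal.ofReal z ^ k *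
          ∫⁻ x, (hardCoreSet σ).indicator 1 ((PointConfig.ofFn x).restrict (window Λ))
            ∂(Measure.pi fun _ : Fin k => ((volume : Measure (EuclideanSpace ℝ ι)).restrict Λ).prod M)))⁻¹ *
      (∑' k : ℕ, ((k.factorial : ℝ≥0∞))⁻¹ * (ENNReal.ofReal z ^ k *
          ∫⁻ x, (A ∩ hardCoreSet σ).indicator 1 ((PointConfig.ofFn x).restrict (window Λ))
            ∂(Measure.pi fun _ : Fin k => ((volume : Measure (EuclideanSpace ℝ ι)).restrict Λ).prod M))) := by
  have hH := measurableSet_hardCoreSet (d := ι) σ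
  set E : ℝ≥0∞ := ENNReal.ofReal (Real.exp (-(z * (volume Λ).toReal))) with hE
  have hE0 : E ≠ 0 := (ENNReal.ofReal_pos.2 (Real.exp_pos _)).ne'
  have hEtop : E ≠ ∞ := ENNReal.ofReal_ne_top
  rw [hsLocalSpec_apply_eq σ _ hΛ ∅ hA, restrict_window_smul_prod, poissonLaw_glue_preimage_eq_tsum' hz M hΛ hb ∅ hH,
    poissonLaw_glue_preimage_eq_tsum' hz M hΛ hb ∅ (hA.inter hH)]
  simp_rw [glue_empty]
  rw [ENNReal.mul_inv (Or.inl hE0) (Or.inl hEtop)]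
  rw [show ∀ X Y : ℝ≥0∞, E⁻¹ * X⁻¹ * (E * Y) = (E⁻¹ * E) * (X⁻¹ * Y) from fun X Y => by ring,
    ENNReal.inv_mul_cancel hE0 hEtop, one_mul]

/-! ## Janossy coefficients and Janossy series of an event -/

section Janossy

variable (M : Measure (EuclideanSpace ℝ ι)) (Λ : Set (EuclideanSpace ℝ ι))

/-- **Janossy coefficients** of an event `S` of configurations in the window `Λ × ℝ³` for the
reference law `Leb|_Λ ⊗ M`: `J_k(S) = ∫ 𝟙_S({x₁, …, x_k}|_{Λ × ℝ³}) d(Leb|_Λ ⊗ M)^{⊗k}`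
(the `k`-particle term of the grand-canonical series). [cite: Ruelle1969, §1.2.1 (2.10)] -/
def janossyCoeff (S : Set (PointConfig (EuclideanSpace ℝ ι × EuclideanSpace ℝ ι))) (k : ℕ) : ℝ≥0∞ :=
  ∫⁻ x, S.indicator 1 ((PointConfig.ofFn x).restrict (window Λ))
    ∂(Measure.pi fun _ : Fin k => ((volume : Measure (EuclideanSpace ℝ ι)).restrict Λ).prod M)

/-- **Janossy series** of an event: `Φ_S(z) = ∑ₖ zᵏ/k! J_k(S)` (a real power series in the activity;
`Φ_{HC}` is the grand-canonical partition function of the hard-sphere gas in `Λ`).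
[cite: Ruelle1969, §1.2.1 (2.11)–(2.12)] -/
def janossySeries (S : Set (PointConfig (EuclideanSpace ℝ ι × EuclideanSpace ℝ ι))) (z : ℝ) : ℝ :=
  ∑' k : ℕ, z ^ k / k.factorial * (janossyCoeff M Λ S k).toReal

/-- Unfolding lemma for `janossyCoeff`. [folklore] -/
theorem janossyCoeff_def (S : Set (PointConfig (EuclideanSpace ℝ ι × EuclideanSpace ℝ ι))) (k : ℕ) :
    janossyCoeff M Λ S k = ∫⁻ x, S.indicator 1 ((PointConfig.ofFn x).restrict (window Λ))
      ∂(Measure.pi fun _ : Fin k => ((volume : Measure (EuclideanSpace ℝ ι)).restrict Λ).prod M) := rfl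

/-- Unfolding lemma for `janossySeries`. [folklore] -/
theorem janossySeries_def (S : Set (PointConfig (EuclideanSpace ℝ ι × EuclideanSpace ℝ ι))) (z : ℝ) :
    janossySeries M Λ S z = ∑' k : ℕ, z ^ k / k.factorial * (janossyCoeff M Λ S k).toReal := rfl

variable {M Λ} [IsProbabilityMeasure M]

/-- `J_k(S) ≤ |Λ|ᵏ`. [folklore] -/
theorem janossyCoeff_le (hb : Bornology.IsBounded Λ) (S : Set (PointConfig (EuclideanSpace ℝ ι × EuclideanSpace ℝ ι))) (k : ℕ) :
    janossyCoeff M Λ S k ≤ volume Λ ^ k :=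
  lintegral_indicator_ofFn_le hb S k

/-- `J_k(S) < ∞`. [folklore] -/
theorem janossyCoeff_ne_top (hb : Bornology.IsBounded Λ) (S : Set (PointConfig (EuclideanSpace ℝ ι × EuclideanSpace ℝ ι))) (k : ℕ) :
    janossyCoeff M Λ S k ≠ ∞ :=
  ne_top_of_le_ne_top (ENNReal.pow_ne_top hb.measure_lt_top.ne) (janossyCoeff_le hb S k)

/-- `J_k(S) ≤ |Λ|ᵏ` in `ℝ`. [folklore] -/
theorem toReal_janossyCoeff_le (hb : Bornology.IsBounded Λ) (S : Set (PointConfig (EuclideanSpace ℝ ι × EuclideanSpace ℝ ι))) (k : ℕ) :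
    (janossyCoeff M Λ S k).toReal ≤ (volume Λ).toReal ^ k := by
  rw [← ENNReal.toReal_pow]
  exact ENNReal.toReal_mono (ENNReal.pow_ne_top hb.measure_lt_top.ne) (janossyCoeff_le hb S k)

omit [IsProbabilityMeasure M] in
/-- Monotonicity of the Janossy coefficients in the event. [folklore] -/
theorem janossyCoeff_mono {S T : Set (PointConfig (EuclideanSpace ℝ ι × EuclideanSpace ℝ ι))} (h : S ⊆ T) (k : ℕ) :
    janossyCoeff M Λ S k ≤ janossyCoeff M Λ T k :=
  lintegral_mono fun _ => indicator_le_indicator_of_subset h (fun _ => bot_le) _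

omit [IsProbabilityMeasure M] in
/-- `J_0(S) = 𝟙_S(∅)`: in particular `J_0(HC) = 1`. [folklore] -/
theorem janossyCoeff_zero (S : Set (PointConfig (EuclideanSpace ℝ ι × EuclideanSpace ℝ ι))) :
    janossyCoeff M Λ S 0 = S.indicator 1 (∅ : PointConfig (EuclideanSpace ℝ ι × EuclideanSpace ℝ ι)) := by
  rw [janossyCoeff_def, Measure.pi_of_empty, lintegral_dirac]
  have : ((PointConfig.ofFn fun a : Fin 0 => isEmptyElim a) : PointConfig (EuclideanSpace ℝ ι × EuclideanSpace ℝ ι)).restrict (window Λ) = ∅ := by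
    refine PointConfig.ext fun y => ?_
    simp only [mem_restrict_iff, PointConfig.mem_ofFn]
    constructor
    · rintro ⟨⟨i, -⟩, -⟩; exact i.elim0
    · intro hy; exact absurd hy (by change y ∉ (∅ : PointConfig (EuclideanSpace ℝ ι × EuclideanSpace ℝ ι)).carrier; simp)
  rw [this]

/-- The terms of the Janossy series are dominated by those of `e^{B|Λ|}` on `|z| ≤ B`. [folklore] -/
theorem norm_term_janossySeries_le (hb : Bornology.IsBounded Λ) (S : Set (PointConfig (EuclideanSpace ℝ ι × EuclideanSpace ℝ ι))) {B z : ℝ}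
    (hz : |z| ≤ B) (k : ℕ) :
    ‖z ^ k / k.factorial * (janossyCoeff M Λ S k).toReal‖ ≤ (B * (volume Λ).toReal) ^ k / k.factorial := by
  rw [Real.norm_eq_abs, abs_mul, abs_div, abs_pow, Nat.abs_cast, abs_of_nonneg ENNReal.toReal_nonneg,
    mul_pow, mul_div_right_comm]
  exact mul_le_mul (div_le_div_of_nonneg_right (pow_le_pow_left₀ (abs_nonneg z) hz k) (Nat.cast_nonneg _))
    (toReal_janossyCoeff_le hb S k) ENNReal.toReal_nonneg
    (div_nonneg (pow_nonneg ((abs_nonneg z).trans hz) _) (Nat.cast_nonneg _))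

/-- The Janossy series converges absolutely for every activity. [folklore] -/
theorem summable_janossySeries (hb : Bornology.IsBounded Λ) (S : Set (PointConfig (EuclideanSpace ℝ ι × EuclideanSpace ℝ ι))) (z : ℝ) :
    Summable fun k : ℕ => z ^ k / k.factorial * (janossyCoeff M Λ S k).toReal :=
  Summable.of_norm_bounded (Real.summable_pow_div_factorial (|z| * (volume Λ).toReal))
    (norm_term_janossySeries_le hb S le_rfl)

omit [IsProbabilityMeasure M] in
/-- The Janossy series is nonnegative for `z ≥ 0`. [folklore] -/
theorem janossySeries_nonneg (S : Set (PointConfig (EuclideanSpace ℝ ι × EuclideanSpace ℝ ι))) {z : ℝ} (hz : 0 ≤ z) :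
    0 ≤ janossySeries M Λ S z :=
  tsum_nonneg fun _ => mul_nonneg (div_nonneg (pow_nonneg hz _) (Nat.cast_nonneg _)) ENNReal.toReal_nonneg

/-- Monotonicity of the Janossy series in the event, for `z ≥ 0`. [folklore] -/
theorem janossySeries_mono (hb : Bornology.IsBounded Λ) {S T : Set (PointConfig (EuclideanSpace ℝ ι × EuclideanSpace ℝ ι))} (h : S ⊆ T)
    {z : ℝ} (hz : 0 ≤ z) : janossySeries M Λ S z ≤ janossySeries M Λ T z := by
  refine (summable_janossySeries hb S z).tsum_le_tsum (fun k => ?_) (summable_janossySeries hb T z)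
  exact mul_le_mul_of_nonneg_left (ENNReal.toReal_mono (janossyCoeff_ne_top hb T k) (janossyCoeff_mono h k))
    (div_nonneg (pow_nonneg hz _) (Nat.cast_nonneg _))

/-- `Φ_{HC}(z) ≥ 1` for `z ≥ 0` (the empty configuration is hard core). [folklore] -/
theorem one_le_janossySeries_hardCoreSet (hb : Bornology.IsBounded Λ) (σ : ℝ) {z : ℝ} (hz : 0 ≤ z) :
    (1 : ℝ) ≤ janossySeries M Λ (hardCoreSet σ : Set (PointConfig (EuclideanSpace ℝ ι × EuclideanSpace ℝ ι))) z := by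
  have h := (summable_janossySeries (M := M) hb (hardCoreSet σ) z).le_tsum 0
    (fun j _ => mul_nonneg (div_nonneg (pow_nonneg hz _) (Nat.cast_nonneg _)) ENNReal.toReal_nonneg)
  rw [janossyCoeff_zero, indicator_of_mem (show (∅ : PointConfig (EuclideanSpace ℝ ι × EuclideanSpace ℝ ι)) ∈ hardCoreSet σ from
    isHardCore_empty σ)] at h
  rw [janossySeries_def]
  simpa using h

/-- **The ENNReal grand-canonical series is `ofReal` of the Janossy series** (`z ≥ 0`):
`∑ₖ (k!)⁻¹ zᵏ J_k(S) = Φ_S(z)`. [folklore] -/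
theorem tsum_eq_ofReal_janossySeries (hb : Bornology.IsBounded Λ) (S : Set (PointConfig (EuclideanSpace ℝ ι × EuclideanSpace ℝ ι))) {z : ℝ}
    (hz : 0 ≤ z) :
    ∑' k : ℕ, ((k.factorial : ℝ≥0∞))⁻¹ * (ENNReal.ofReal z ^ k * janossyCoeff M Λ S k) =
      ENNReal.ofReal (janossySeries M Λ S z) := by
  have hnn : ∀ k : ℕ, 0 ≤ z ^ k / k.factorial * (janossyCoeff M Λ S k).toReal := fun k =>
    mul_nonneg (div_nonneg (pow_nonneg hz _) (Nat.cast_nonneg _)) ENNReal.toReal_nonneg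
  rw [janossySeries_def, ENNReal.ofReal_tsum_of_nonneg hnn (summable_janossySeries hb S z)]
  refine tsum_congr fun k => ?_
  rw [ENNReal.ofReal_mul (div_nonneg (pow_nonneg hz _) (Nat.cast_nonneg _)),
    ENNReal.ofReal_div_of_pos (by exact_mod_cast k.factorial_pos), ENNReal.ofReal_pow hz, ENNReal.ofReal_natCast,
    ENNReal.ofReal_toReal (janossyCoeff_ne_top hb S k), div_eq_mul_inv]
  ring

/-- **The free finite-volume hard-sphere probabilities as ratios of Janossy series**:
`γ^z_Λ(A) = Φ_{A ∩ HC}(z) / Φ_{HC}(z)` for `ν_z = z · Leb ⊗ M`, `z ≥ 0`.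
[cite: Ruelle1969, §1.2.1 (2.10)–(2.12)] -/
theorem hsLocalSpec_empty_toReal_eq_div [Nonempty ι] {z : ℝ} (hz : 0 ≤ z) (σ : ℝ) (hΛ : MeasurableSet Λ)
    (hb : Bornology.IsBounded Λ) {A : Set (PointConfig (EuclideanSpace ℝ ι × EuclideanSpace ℝ ι))} (hA : MeasurableSet A) :
    (hsLocalSpec σ ((Real.toNNReal z) • ((volume : Measure (EuclideanSpace ℝ ι)).prod M)) Λ ∅ A).toReal =
      janossySeries M Λ (A ∩ hardCoreSet σ) z / janossySeries M Λ (hardCoreSet σ) z := by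
  rw [hsLocalSpec_empty_apply_eq hz M σ hΛ hb hA]
  change ((∑' k : ℕ, ((k.factorial : ℝ≥0∞))⁻¹ * (ENNReal.ofReal z ^ k * janossyCoeff M Λ (hardCoreSet σ) k))⁻¹ *
    ∑' k : ℕ, ((k.factorial : ℝ≥0∞))⁻¹ * (ENNReal.ofReal z ^ k * janossyCoeff M Λ (A ∩ hardCoreSet σ) k)).toReal = _
  rw [tsum_eq_ofReal_janossySeries hb _ hz, tsum_eq_ofReal_janossySeries hb _ hz, ENNReal.toReal_mul,
    ENNReal.toReal_inv, ENNReal.toReal_ofReal (janossySeries_nonneg _ hz),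
    ENNReal.toReal_ofReal (janossySeries_nonneg _ hz), inv_mul_eq_div]

/-! ### Term-by-term differentiation -/

/-- The shifted series `Φ⁽¹⁾_S(z) = ∑ₖ zᵏ/k! J_{k+1}(S)` converges absolutely. [folklore] -/
theorem summable_janossySeries_succ (hb : Bornology.IsBounded Λ) (S : Set (PointConfig (EuclideanSpace ℝ ι × EuclideanSpace ℝ ι))) (z : ℝ) :
    Summable fun k : ℕ => z ^ k / k.factorial * (janossyCoeff M Λ S (k + 1)).toReal := by
  set V : ℝ := (volume Λ).toReal with hV
  have hV0 : 0 ≤ V := ENNReal.toReal_nonneg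
  refine Summable.of_norm_bounded ((Real.summable_pow_div_factorial (|z| * V)).mul_left V) fun k => ?_
  rw [Real.norm_eq_abs, abs_mul, abs_div, abs_pow, Nat.abs_cast, abs_of_nonneg ENNReal.toReal_nonneg]
  calc |z| ^ k / k.factorial * (janossyCoeff M Λ S (k + 1)).toReal ≤ |z| ^ k / k.factorial * V ^ (k + 1) :=
        mul_le_mul_of_nonneg_left (toReal_janossyCoeff_le hb S (k + 1))
          (div_nonneg (pow_nonneg (abs_nonneg z) _) (Nat.cast_nonneg _))
    _ = V * ((|z| * V) ^ k / k.factorial) := by rw [mul_pow, pow_succ]; ring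

/-- **The Janossy series is differentiable in the activity, with derivative the shifted series**:
`Φ_S'(z) = ∑ₖ zᵏ/k! J_{k+1}(S)` (term-by-term differentiation of an entire power series).
[cite: Ruelle1969, §4.2] -/
theorem hasDerivAt_janossySeries (hb : Bornology.IsBounded Λ) (S : Set (PointConfig (EuclideanSpace ℝ ι × EuclideanSpace ℝ ι))) (z : ℝ) :
    HasDerivAt (janossySeries M Λ S)
      (∑' k : ℕ, z ^ k / k.factorial * (janossyCoeff M Λ S (k + 1)).toReal) z := by
  set V : ℝ := (volume Λ).toReal with hV
  have hV0 : 0 ≤ V := ENNReal.toReal_nonneg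
  set a : ℕ → ℝ := fun k => (janossyCoeff M Λ S k).toReal with ha
  have ha0 : ∀ k, 0 ≤ a k := fun k => ENNReal.toReal_nonneg
  have haV : ∀ k, a k ≤ V ^ k := fun k => toReal_janossyCoeff_le hb S k
  set B : ℝ := |z| + 1 with hB
  have hB0 : 0 < B := by positivity
  set g : ℕ → ℝ → ℝ := fun k y => y ^ k / k.factorial * a k with hg
  set g' : ℕ → ℝ → ℝ := fun k y => (k * y ^ (k - 1)) / k.factorial * a k with hg'
  set u : ℕ → ℝ := fun k => (k * B ^ (k - 1)) / k.factorial * V ^ k with hu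
  have hderiv : ∀ k y, HasDerivAt (g k) (g' k y) y := fun k y => by
    simp only [hg, hg']
    exact ((hasDerivAt_pow k y).div_const _).mul_const _
  have hbound : ∀ k y, y ∈ Ioo (-B) B → ‖g' k y‖ ≤ u k := by
    intro k y hy
    have hyB : |y| ≤ B := abs_le.2 ⟨hy.1.le, hy.2.le⟩
    simp only [hg', hu, Real.norm_eq_abs, abs_mul, abs_div, Nat.abs_cast, abs_pow, abs_of_nonneg (ha0 k)]
    refine mul_le_mul (div_le_div_of_nonneg_right ?_ (Nat.cast_nonneg _)) (haV k) (ha0 k)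
      (div_nonneg (mul_nonneg (Nat.cast_nonneg _) (pow_nonneg hB0.le _)) (Nat.cast_nonneg _))
    exact mul_le_mul_of_nonneg_left (pow_le_pow_left₀ (abs_nonneg y) hyB _) (Nat.cast_nonneg _)
  have hu_sum : Summable u := by
    rw [← summable_nat_add_iff 1]
    have h := (Real.summable_pow_div_factorial (B * V)).mul_left V
    refine (congrArg Summable (funext fun k => ?_)).mp h
    simp only [hu, Nat.cast_add, Nat.cast_one, Nat.add_sub_cancel, Nat.factorial_succ, Nat.cast_mul,
      mul_pow, pow_succ]
    have hk : ((k : ℝ) + 1) ≠ 0 := by positivity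
    have hf : (k.factorial : ℝ) ≠ 0 := by positivity
    field_simp
  have hg0 : Summable fun k => g k 0 := by
    refine Summable.of_norm_bounded (Real.summable_pow_div_factorial (B * V)) fun k => ?_
    simpa [hg, ha] using norm_term_janossySeries_le hb S (show |(0 : ℝ)| ≤ B by simp [hB0.le]) k
  have hz : z ∈ Ioo (-B) B := by
    constructor <;> [have := neg_abs_le z; have := le_abs_self z] <;> simp only [hB] <;> linarith
  have h := hasDerivAt_tsum_of_isPreconnected hu_sum isOpen_Ioo isPreconnected_Ioo (fun k y _ => hderiv k y)
    hbound (show (0 : ℝ) ∈ Ioo (-B) B from ⟨by linarith, hB0⟩) hg0 hz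
  have hfun : (fun y => ∑' k, g k y) = janossySeries M Λ S := by
    funext y; rfl
  rw [hfun] at h
  -- reindex the derivative series
  have hsum' : Summable fun k => g' k z := Summable.of_norm_bounded hu_sum fun k => hbound k z hz
  have hreindex : ∑' k, g' k z = ∑' k : ℕ, z ^ k / k.factorial * (janossyCoeff M Λ S (k + 1)).toReal := by
    rw [hsum'.tsum_eq_zero_add]
    have h0 : g' 0 z = 0 := by simp [hg']
    rw [h0, zero_add]
    refine tsum_congr fun k => ?_
    simp only [hg', ha, Nat.cast_add, Nat.cast_one, Nat.add_sub_cancel, Nat.factorial_succ, Nat.cast_mul]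
    have hk : ((k : ℝ) + 1) ≠ 0 := by positivity
    have hf : (k.factorial : ℝ) ≠ 0 := by positivity
    field_simp
  rwa [hreindex] at h

/-! ### Splitting off the first thrown particle -/

/-- Inserting the point `a`: `c ↦ c ∪ {a}` is measurable. [folklore] -/
theorem measurable_union_ofFn_const (a : EuclideanSpace ℝ ι × EuclideanSpace ℝ ι) :
    Measurable fun c : PointConfig (EuclideanSpace ℝ ι × EuclideanSpace ℝ ι) => c ∪ PointConfig.ofFn fun _ : Fin 1 => a :=
  (PointConfig.measurable_union_ofFn 1).comp (measurable_const.prodMk measurable_id)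

/-- Inserting a point is jointly measurable in the point and the configuration. [folklore] -/
theorem measurable_union_ofFn_fst :
    Measurable fun p : (EuclideanSpace ℝ ι × EuclideanSpace ℝ ι) × PointConfig (EuclideanSpace ℝ ι × EuclideanSpace ℝ ι) => p.2 ∪ PointConfig.ofFn fun _ : Fin 1 => p.1 :=
  (PointConfig.measurable_union_ofFn 1).comp ((measurable_pi_lambda _ fun _ => measurable_fst).prodMk measurable_snd)

omit [IsProbabilityMeasure M] [Fintype ι] in
/-- `{a, y₁, …, y_k}|_Λ = {y₁, …, y_k}|_Λ ∪ {a}` for `a` in the window. [folklore] -/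
theorem restrict_ofFn_cons_of_mem {k : ℕ} {a : EuclideanSpace ℝ ι × EuclideanSpace ℝ ι} (ha : a ∈ window Λ) (y : Fin k → (EuclideanSpace ℝ ι × EuclideanSpace ℝ ι)) :
    (PointConfig.ofFn (Fin.cons a y : Fin (k + 1) → (EuclideanSpace ℝ ι × EuclideanSpace ℝ ι))).restrict (window Λ) =
      (PointConfig.ofFn y).restrict (window Λ) ∪ PointConfig.ofFn fun _ : Fin 1 => a := by
  rw [← PointConfig.ofFn_union_ofFn_one, restrict_union']
  congr 1
  refine PointConfig.ext fun x => ?_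
  simp only [mem_restrict_iff, PointConfig.mem_ofFn]
  constructor
  · rintro ⟨h, -⟩; exact h
  · rintro ⟨i, rfl⟩; exact ⟨⟨i, rfl⟩, ha⟩

omit [IsProbabilityMeasure M] in
/-- Almost every thrown particle lies in the window. [folklore] -/
theorem ae_mem_window (hΛ : MeasurableSet Λ) [SFinite M] :
    ∀ᵐ a ∂(((volume : Measure (EuclideanSpace ℝ ι)).restrict Λ).prod M), a ∈ window Λ := by
  rw [ae_iff]
  have hsub : {a : EuclideanSpace ℝ ι × EuclideanSpace ℝ ι | a ∉ window Λ} ⊆ Λᶜ ×ˢ (univ : Set (EuclideanSpace ℝ ι)) := fun a ha =>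
    ⟨by simpa [mem_window] using ha, mem_univ _⟩
  refine measure_mono_null hsub ?_
  rw [Measure.prod_prod, Measure.restrict_apply hΛ.compl, compl_inter_self, measure_empty, zero_mul]

omit [IsProbabilityMeasure M] in
/-- The Janossy coefficient of the inserted event `S^a = {c | c ∪ {a} ∈ S}`, as an integral of
`𝟙_S({y}|_Λ ∪ {a})`. [folklore] -/
theorem janossyCoeff_preimage_union_eq {S : Set (PointConfig (EuclideanSpace ℝ ι × EuclideanSpace ℝ ι))} (a : EuclideanSpace ℝ ι × EuclideanSpace ℝ ι) (k : ℕ) :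
    janossyCoeff M Λ ((fun c : PointConfig (EuclideanSpace ℝ ι × EuclideanSpace ℝ ι) => c ∪ PointConfig.ofFn fun _ : Fin 1 => a) ⁻¹' S) k =
      ∫⁻ y, S.indicator 1 ((PointConfig.ofFn y).restrict (window Λ) ∪ PointConfig.ofFn fun _ : Fin 1 => a)
        ∂(Measure.pi fun _ : Fin k => ((volume : Measure (EuclideanSpace ℝ ι)).restrict Λ).prod M) := by
  rw [janossyCoeff_def]
  refine lintegral_congr fun y => ?_
  exact indicator_comp_right (fun c : PointConfig (EuclideanSpace ℝ ι × EuclideanSpace ℝ ι) => c ∪ PointConfig.ofFn fun _ : Fin 1 => a)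
    (g := (1 : PointConfig (EuclideanSpace ℝ ι × EuclideanSpace ℝ ι) → ℝ≥0∞))

/-- The Janossy coefficients of the inserted events are measurable in the inserted point.
[folklore] -/
theorem measurable_janossyCoeff_preimage_union (hΛ : MeasurableSet Λ) {S : Set (PointConfig (EuclideanSpace ℝ ι × EuclideanSpace ℝ ι))}
    (hS : MeasurableSet S) (k : ℕ) :
    Measurable fun a : EuclideanSpace ℝ ι × EuclideanSpace ℝ ι =>
      janossyCoeff M Λ ((fun c : PointConfig (EuclideanSpace ℝ ι × EuclideanSpace ℝ ι) => c ∪ PointConfig.ofFn fun _ : Fin 1 => a) ⁻¹' S) k := by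
  simp_rw [janossyCoeff_preimage_union_eq]
  have hW := measurableSet_window hΛ
  haveI : SigmaFinite (((volume : Measure (EuclideanSpace ℝ ι)).restrict Λ).prod M) := inferInstance
  haveI : SigmaFinite (Measure.pi fun _ : Fin k => ((volume : Measure (EuclideanSpace ℝ ι)).restrict Λ).prod M) := inferInstance
  have h : Measurable fun p : (EuclideanSpace ℝ ι × EuclideanSpace ℝ ι) × (Fin k → (EuclideanSpace ℝ ι × EuclideanSpace ℝ ι)) =>
      S.indicator (1 : PointConfig (EuclideanSpace ℝ ι × EuclideanSpace ℝ ι) → ℝ≥0∞)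
        ((PointConfig.ofFn p.2).restrict (window Λ) ∪ PointConfig.ofFn fun _ : Fin 1 => p.1) :=
    (measurable_one.indicator hS).comp (measurable_union_ofFn_fst.comp (measurable_fst.prodMk
      (((PointConfig.measurable_restrict hW).comp (measurable_ofFn_phase k)).comp measurable_snd)))
  exact h.lintegral_prod_right'

/-- **Splitting off the first thrown particle**: `J_{k+1}(S) = ∫ J_k(S^a) d(Leb|_Λ ⊗ M)(a)` with
`S^a = {c | c ∪ {a} ∈ S}` (Fubini for `π^{⊗(k+1)} = π ⊗ π^{⊗k}` and `{a, y}|_Λ = {y}|_Λ ∪ {a}`).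
[cite: LastPenrose2017, Thm 4.1] -/
theorem janossyCoeff_succ (hΛ : MeasurableSet Λ) {S : Set (PointConfig (EuclideanSpace ℝ ι × EuclideanSpace ℝ ι))} (hS : MeasurableSet S) (k : ℕ) :
    janossyCoeff M Λ S (k + 1) =
      ∫⁻ a, janossyCoeff M Λ ((fun c : PointConfig (EuclideanSpace ℝ ι × EuclideanSpace ℝ ι) => c ∪ PointConfig.ofFn fun _ : Fin 1 => a) ⁻¹' S) k
        ∂(((volume : Measure (EuclideanSpace ℝ ι)).restrict Λ).prod M) := by
  set π : Measure (EuclideanSpace ℝ ι × EuclideanSpace ℝ ι) := ((volume : Measure (EuclideanSpace ℝ ι)).restrict Λ).prod M with hπ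
  have hW := measurableSet_window hΛ
  have hg : Measurable fun x : Fin (k + 1) → (EuclideanSpace ℝ ι × EuclideanSpace ℝ ι) =>
      S.indicator (1 : PointConfig (EuclideanSpace ℝ ι × EuclideanSpace ℝ ι) → ℝ≥0∞) ((PointConfig.ofFn x).restrict (window Λ)) :=
    (measurable_one.indicator hS).comp ((PointConfig.measurable_restrict hW).comp (measurable_ofFn_phase (k + 1)))
  rw [janossyCoeff_def, IsPoissonPointProcess.lintegral_pi_succ_eq_lintegral_lintegral_cons π k hg]
  refine lintegral_congr_ae ?_
  filter_upwards [ae_mem_window (M := M) hΛ] with a ha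
  rw [janossyCoeff_preimage_union_eq]
  refine lintegral_congr fun y => ?_
  simp only [restrict_ofFn_cons_of_mem ha y]

/-- **The derivative of the Janossy series as an integral over the inserted particle**:
`∑ₖ zᵏ/k! J_{k+1}(S) = ∫ Φ_{S^a}(z) d(Leb|_Λ ⊗ M)(a)`. [cite: Ruelle1969, §4.2] -/
theorem tsum_janossyCoeff_succ_eq_integral (hΛ : MeasurableSet Λ) (hb : Bornology.IsBounded Λ)
    {S : Set (PointConfig (EuclideanSpace ℝ ι × EuclideanSpace ℝ ι))} (hS : MeasurableSet S) (z : ℝ) :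
    ∑' k : ℕ, z ^ k / k.factorial * (janossyCoeff M Λ S (k + 1)).toReal =
      ∫ a, janossySeries M Λ ((fun c : PointConfig (EuclideanSpace ℝ ι × EuclideanSpace ℝ ι) => c ∪ PointConfig.ofFn fun _ : Fin 1 => a) ⁻¹' S) z
        ∂(((volume : Measure (EuclideanSpace ℝ ι)).restrict Λ).prod M) := by
  set π : Measure (EuclideanSpace ℝ ι × EuclideanSpace ℝ ι) := ((volume : Measure (EuclideanSpace ℝ ι)).restrict Λ).prod M with hπ
  haveI : IsFiniteMeasure π := isFiniteMeasure_restrict_prod hb M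
  set V : ℝ := (volume Λ).toReal with hV
  set ins : EuclideanSpace ℝ ι × EuclideanSpace ℝ ι → PointConfig (EuclideanSpace ℝ ι × EuclideanSpace ℝ ι) → PointConfig (EuclideanSpace ℝ ι × EuclideanSpace ℝ ι) :=
    fun a c => c ∪ PointConfig.ofFn fun _ : Fin 1 => a with hins
  have hmeas : ∀ k, Measurable fun a : EuclideanSpace ℝ ι × EuclideanSpace ℝ ι => (janossyCoeff M Λ (ins a ⁻¹' S) k).toReal := fun k =>
    (measurable_janossyCoeff_preimage_union hΛ hS k).ennreal_toReal
  -- each term is integrable, with the summable bounds `(|z| V)^k / k! · π(univ)`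
  have hterm_bound : ∀ k (a : EuclideanSpace ℝ ι × EuclideanSpace ℝ ι), ‖z ^ k / k.factorial * (janossyCoeff M Λ (ins a ⁻¹' S) k).toReal‖ ≤
      (|z| * V) ^ k / k.factorial := fun k a => norm_term_janossySeries_le hb _ le_rfl k
  have hint : ∫ a, janossySeries M Λ (ins a ⁻¹' S) z ∂π =
      ∑' k : ℕ, ∫ a, z ^ k / k.factorial * (janossyCoeff M Λ (ins a ⁻¹' S) k).toReal ∂π := by
    simp only [janossySeries_def]
    refine integral_tsum (fun k => ((hmeas k).const_mul _).aestronglyMeasurable) ?_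
    have hle : ∀ k, ∫⁻ a, ‖z ^ k / k.factorial * (janossyCoeff M Λ (ins a ⁻¹' S) k).toReal‖ₑ ∂π ≤
        ENNReal.ofReal ((|z| * V) ^ k / k.factorial) * π univ := fun k => by
      rw [← lintegral_const]
      refine lintegral_mono fun a => ?_
      rw [← ofReal_norm]
      exact ENNReal.ofReal_le_ofReal (hterm_bound k a)
    refine ne_top_of_le_ne_top ?_ (ENNReal.tsum_le_tsum hle)
    rw [ENNReal.tsum_mul_right]
    refine ENNReal.mul_ne_top ?_ (measure_ne_top π univ)
    rw [← ENNReal.ofReal_tsum_of_nonneg (fun k => div_nonneg (pow_nonneg (mul_nonneg (abs_nonneg z)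
      ENNReal.toReal_nonneg) _) (Nat.cast_nonneg _)) (Real.summable_pow_div_factorial _)]
    exact ENNReal.ofReal_ne_top
  rw [hint]
  refine tsum_congr fun k => ?_
  rw [integral_const_mul, janossyCoeff_succ hΛ hS k, integral_toReal
    (measurable_janossyCoeff_preimage_union hΛ hS k).aemeasurable
    (ae_of_all _ fun a => (janossyCoeff_ne_top hb _ k).lt_top)]

/-! ### A fixed particle is almost surely absent; inserting a particle into the events -/

/-- **A fixed phase point is a.s. not a particle** of the free finite-volume distribution
(it is absolutely continuous with respect to a Poisson law with atomless intensity).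
[folklore] -/
theorem hsLocalSpec_empty_apply_count_singleton_ne_zero {ν : Measure (EuclideanSpace ℝ ι × EuclideanSpace ℝ ι)} [IsLocallyFiniteMeasure ν]
    (h0 : ∀ x, ν {x} = 0) (σ : ℝ) (hΛ : MeasurableSet Λ) (a : EuclideanSpace ℝ ι × EuclideanSpace ℝ ι) :
    hsLocalSpec σ ν Λ ∅ {c : PointConfig (EuclideanSpace ℝ ι × EuclideanSpace ℝ ι) | c.count {a} ≠ 0} = 0 := by
  have hmeas : MeasurableSet {c : PointConfig (EuclideanSpace ℝ ι × EuclideanSpace ℝ ι) | c.count {a} ≠ 0} :=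
    measurableSet_count_ne_zero (measurableSet_singleton a)
  rw [hsLocalSpec_apply_eq σ ν hΛ ∅ hmeas]
  refine mul_eq_zero_of_right _ (measure_mono_null ?_
    ((isPoissonPointProcess_poissonLaw_restrict' ν h0 (window Λ)).measure_setOf_mem_eq_zero
      (measurableSet_singleton a)))
  intro ξ hξ
  have h1 : (glue Λ ∅ ξ).count {a} ≠ 0 := hξ.1
  rw [glue_empty, PointConfig.count_restrict] at h1
  obtain ⟨x, hx⟩ := Set.encard_ne_zero.1 h1
  have hxa : x = a := hx.2.2
  subst hxa
  exact hx.1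

/-- Two events agreeing off the null event "`a` is a particle" have the same probability.
[folklore] -/
theorem hsLocalSpec_empty_apply_congr_off_atom {ν : Measure (EuclideanSpace ℝ ι × EuclideanSpace ℝ ι)} [IsLocallyFiniteMeasure ν]
    (h0 : ∀ x, ν {x} = 0) (σ : ℝ) (hΛ : MeasurableSet Λ) (a : EuclideanSpace ℝ ι × EuclideanSpace ℝ ι) {S T : Set (PointConfig (EuclideanSpace ℝ ι × EuclideanSpace ℝ ι))}
    (hST : S ∩ {c : PointConfig (EuclideanSpace ℝ ι × EuclideanSpace ℝ ι) | c.count {a} = 0} = T ∩ {c : PointConfig (EuclideanSpace ℝ ι × EuclideanSpace ℝ ι) | c.count {a} = 0}) :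
    hsLocalSpec σ ν Λ ∅ S = hsLocalSpec σ ν Λ ∅ T := by
  have hnull : hsLocalSpec σ ν Λ ∅ {c : PointConfig (EuclideanSpace ℝ ι × EuclideanSpace ℝ ι) | c.count {a} = 0}ᶜ = 0 := by
    rw [show ({c : PointConfig (EuclideanSpace ℝ ι × EuclideanSpace ℝ ι) | c.count {a} = 0}ᶜ : Set (PointConfig (EuclideanSpace ℝ ι × EuclideanSpace ℝ ι))) =
      {c : PointConfig (EuclideanSpace ℝ ι × EuclideanSpace ℝ ι) | c.count {a} ≠ 0} from Set.ext fun _ => Iff.rfl]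
    exact hsLocalSpec_empty_apply_count_singleton_ne_zero h0 σ hΛ a
  rw [← measure_inter_conull hnull, hST, measure_inter_conull hnull]

omit [Fintype ι] in
/-- `a` is not a particle of `c` iff `N_c({a}) = 0`. [folklore] -/
theorem count_singleton_eq_zero_iff {c : PointConfig (EuclideanSpace ℝ ι × EuclideanSpace ℝ ι)} {a : EuclideanSpace ℝ ι × EuclideanSpace ℝ ι} : c.count {a} = 0 ↔ a ∉ c := by
  rw [count_eq_zero_iff']
  exact ⟨fun h ha => h a ha rfl, fun h x hx hxa => h (by rw [mem_singleton_iff] at hxa; exact hxa ▸ hx)⟩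

/-- **Inserting a particle into the hard-core event**: off the null event "`a` is a particle",
`{c | c ∪ {a} hard core} = HC ∩ {N(B°_σ(a) × ℝ³) = 0}`. [folklore] -/
theorem preimage_union_hardCoreSet_inter (σ : ℝ) (a : EuclideanSpace ℝ ι × EuclideanSpace ℝ ι) :
    (fun c : PointConfig (EuclideanSpace ℝ ι × EuclideanSpace ℝ ι) => c ∪ PointConfig.ofFn fun _ : Fin 1 => a) ⁻¹' hardCoreSet σ ∩
        {c : PointConfig (EuclideanSpace ℝ ι × EuclideanSpace ℝ ι) | c.count {a} = 0} =
      (hardCoreSet σ ∩ {c : PointConfig (EuclideanSpace ℝ ι × EuclideanSpace ℝ ι) | c.count (window (Metric.ball a.1 σ)) = 0}) ∩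
        {c : PointConfig (EuclideanSpace ℝ ι × EuclideanSpace ℝ ι) | c.count {a} = 0} := by
  ext c
  simp only [mem_inter_iff, mem_preimage, mem_setOf_eq, mem_hardCoreSet]
  constructor
  · rintro ⟨h, ha⟩
    exact ⟨(isHardCore_union_ofFn_one_iff (count_singleton_eq_zero_iff.1 ha)).1 h, ha⟩
  · rintro ⟨h, ha⟩
    exact ⟨(isHardCore_union_ofFn_one_iff (count_singleton_eq_zero_iff.1 ha)).2 h, ha⟩

omit [Fintype ι] in
/-- **Inserting a particle outside a window into its vacancy event** does not change it (off the
null event). [folklore] -/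
theorem preimage_union_setOf_count_eq_zero_inter_of_notMem {W : Set (EuclideanSpace ℝ ι × EuclideanSpace ℝ ι)} {a : EuclideanSpace ℝ ι × EuclideanSpace ℝ ι} (ha : a ∉ W)
    (T : Set (PointConfig (EuclideanSpace ℝ ι × EuclideanSpace ℝ ι))) :
    (fun c : PointConfig (EuclideanSpace ℝ ι × EuclideanSpace ℝ ι) => c ∪ PointConfig.ofFn fun _ : Fin 1 => a) ⁻¹'
          ({c : PointConfig (EuclideanSpace ℝ ι × EuclideanSpace ℝ ι) | c.count W = 0} ∩ T) ∩ {c : PointConfig (EuclideanSpace ℝ ι × EuclideanSpace ℝ ι) | c.count {a} = 0} =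
      ({c : PointConfig (EuclideanSpace ℝ ι × EuclideanSpace ℝ ι) | c.count W = 0} ∩
        (fun c : PointConfig (EuclideanSpace ℝ ι × EuclideanSpace ℝ ι) => c ∪ PointConfig.ofFn fun _ : Fin 1 => a) ⁻¹' T) ∩
          {c : PointConfig (EuclideanSpace ℝ ι × EuclideanSpace ℝ ι) | c.count {a} = 0} := by
  classical
  ext c
  simp only [mem_inter_iff, mem_preimage, mem_setOf_eq, PointConfig.count_union_ofFn_one, ha, false_and,
    if_false, add_zero]

omit [Fintype ι] in
/-- **Inserting a particle inside a window kills its vacancy event** (off the null event).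
[folklore] -/
theorem preimage_union_setOf_count_eq_zero_inter_of_mem {W : Set (EuclideanSpace ℝ ι × EuclideanSpace ℝ ι)} {a : EuclideanSpace ℝ ι × EuclideanSpace ℝ ι} (ha : a ∈ W)
    (T : Set (PointConfig (EuclideanSpace ℝ ι × EuclideanSpace ℝ ι))) :
    (fun c : PointConfig (EuclideanSpace ℝ ι × EuclideanSpace ℝ ι) => c ∪ PointConfig.ofFn fun _ : Fin 1 => a) ⁻¹'
          ({c : PointConfig (EuclideanSpace ℝ ι × EuclideanSpace ℝ ι) | c.count W = 0} ∩ T) ∩ {c : PointConfig (EuclideanSpace ℝ ι × EuclideanSpace ℝ ι) | c.count {a} = 0} =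
      (∅ : Set (PointConfig (EuclideanSpace ℝ ι × EuclideanSpace ℝ ι))) ∩ {c : PointConfig (EuclideanSpace ℝ ι × EuclideanSpace ℝ ι) | c.count {a} = 0} := by
  classical
  ext c
  simp only [mem_inter_iff, mem_preimage, mem_setOf_eq, empty_inter, mem_empty_iff_false, iff_false, not_and]
  intro h hc
  rw [PointConfig.count_union_ofFn_one, if_pos ⟨ha, count_singleton_eq_zero_iff.1 hc⟩] at h
  exact absurd h.1 (by simp)

end Janossy


/-! ## The activity derivative of the free finite-volume probabilities -/

section ActivityDerivative

variable (M : Measure (EuclideanSpace ℝ ι)) [IsProbabilityMeasure M] {σ : ℝ} {Λ : Set (EuclideanSpace ℝ ι)}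

/-- `a ↦ γ_Λ(∅)({c | c ∪ {a} ∈ S})` is measurable. [folklore] -/
theorem measurable_hsLocalSpec_empty_preimage_union (σ : ℝ) (ν : Measure (EuclideanSpace ℝ ι × EuclideanSpace ℝ ι)) (Λ : Set (EuclideanSpace ℝ ι))
    {S : Set (PointConfig (EuclideanSpace ℝ ι × EuclideanSpace ℝ ι))} (hS : MeasurableSet S) :
    Measurable fun a : EuclideanSpace ℝ ι × EuclideanSpace ℝ ι =>
      hsLocalSpec σ ν Λ ∅ ((fun c : PointConfig (EuclideanSpace ℝ ι × EuclideanSpace ℝ ι) => c ∪ PointConfig.ofFn fun _ : Fin 1 => a) ⁻¹' S) := by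
  haveI := isFiniteMeasure_hsLocalSpec σ ν Λ ∅
  have h : Measurable fun p : (EuclideanSpace ℝ ι × EuclideanSpace ℝ ι) × PointConfig (EuclideanSpace ℝ ι × EuclideanSpace ℝ ι) =>
      S.indicator (1 : PointConfig (EuclideanSpace ℝ ι × EuclideanSpace ℝ ι) → ℝ≥0∞) (p.2 ∪ PointConfig.ofFn fun _ : Fin 1 => p.1) :=
    (measurable_one.indicator hS).comp measurable_union_ofFn_fst
  have heq : (fun a : EuclideanSpace ℝ ι × EuclideanSpace ℝ ι => hsLocalSpec σ ν Λ ∅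
      ((fun c : PointConfig (EuclideanSpace ℝ ι × EuclideanSpace ℝ ι) => c ∪ PointConfig.ofFn fun _ : Fin 1 => a) ⁻¹' S)) =
      fun a => ∫⁻ c, S.indicator (1 : PointConfig (EuclideanSpace ℝ ι × EuclideanSpace ℝ ι) → ℝ≥0∞) (c ∪ PointConfig.ofFn fun _ : Fin 1 => a)
        ∂(hsLocalSpec σ ν Λ ∅) := by
    funext a
    rw [← lintegral_indicator_one (hS.preimage (measurable_union_ofFn_const a))]
    refine lintegral_congr fun c => ?_
    exact indicator_comp_right (fun c : PointConfig (EuclideanSpace ℝ ι × EuclideanSpace ℝ ι) => c ∪ PointConfig.ofFn fun _ : Fin 1 => a)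
      (g := (1 : PointConfig (EuclideanSpace ℝ ι × EuclideanSpace ℝ ι) → ℝ≥0∞))
  rw [heq]
  exact h.lintegral_prod_right'

/-- The inserted hard-core event is contained in the hard-core event (hard core is hereditary).
[folklore] -/
theorem preimage_union_inter_hardCoreSet_subset (σ : ℝ) (a : EuclideanSpace ℝ ι × EuclideanSpace ℝ ι) (A : Set (PointConfig (EuclideanSpace ℝ ι × EuclideanSpace ℝ ι))) :
    (fun c : PointConfig (EuclideanSpace ℝ ι × EuclideanSpace ℝ ι) => c ∪ PointConfig.ofFn fun _ : Fin 1 => a) ⁻¹' (A ∩ hardCoreSet σ) ⊆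
      hardCoreSet σ :=
  fun _ hc => isHardCore_of_subset hc.2 fun _ hx => Or.inl hx

/-- **Ruelle's formula for the activity derivative of a finite-volume Gibbs probability**: for
`ν_z = z · Leb ⊗ M`, a bounded Borel window `Λ`, a measurable event `A` and `z ≥ 0`, the ratio
`Φ_{A∩HC}/Φ_{HC}` (which is `γ^z_Λ(∅)(A)` for nonnegative activity) has derivative
`∫ (γ^z_Λ(∅)((A ∩ HC)^a) - γ^z_Λ(∅)(A) · γ^z_Λ(∅)(HC^a)) d(Leb|_Λ ⊗ M)(a)`, `S^a = {c | c ∪ {a} ∈ S}` —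
the covariance of `𝟙_A` with the insertion of one particle. [cite: Ruelle1969, §4.2] -/
theorem hasDerivAt_div_janossySeries [Nonempty ι] (σ : ℝ) (hΛ : MeasurableSet Λ) (hb : Bornology.IsBounded Λ)
    {A : Set (PointConfig (EuclideanSpace ℝ ι × EuclideanSpace ℝ ι))} (hA : MeasurableSet A) {z : ℝ} (hz : 0 ≤ z) :
    HasDerivAt (fun y => janossySeries M Λ (A ∩ hardCoreSet σ) y / janossySeries M Λ (hardCoreSet σ) y)
      (∫ a, ((hsLocalSpec σ ((Real.toNNReal z) • ((volume : Measure (EuclideanSpace ℝ ι)).prod M)) Λ ∅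
          ((fun c : PointConfig (EuclideanSpace ℝ ι × EuclideanSpace ℝ ι) => c ∪ PointConfig.ofFn fun _ : Fin 1 => a) ⁻¹' (A ∩ hardCoreSet σ))).toReal -
        (hsLocalSpec σ ((Real.toNNReal z) • ((volume : Measure (EuclideanSpace ℝ ι)).prod M)) Λ ∅ A).toReal *
          (hsLocalSpec σ ((Real.toNNReal z) • ((volume : Measure (EuclideanSpace ℝ ι)).prod M)) Λ ∅
            ((fun c : PointConfig (EuclideanSpace ℝ ι × EuclideanSpace ℝ ι) => c ∪ PointConfig.ofFn fun _ : Fin 1 => a) ⁻¹' hardCoreSet σ)).toReal)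
        ∂(((volume : Measure (EuclideanSpace ℝ ι)).restrict Λ).prod M)) z := by
  set π : Measure (EuclideanSpace ℝ ι × EuclideanSpace ℝ ι) := ((volume : Measure (EuclideanSpace ℝ ι)).restrict Λ).prod M with hπ
  haveI : IsFiniteMeasure π := isFiniteMeasure_restrict_prod hb M
  set P := hsLocalSpec σ ((Real.toNNReal z) • ((volume : Measure (EuclideanSpace ℝ ι)).prod M)) Λ ∅ with hP
  haveI : IsFiniteMeasure P := isFiniteMeasure_hsLocalSpec σ _ Λ ∅
  set ins : EuclideanSpace ℝ ι × EuclideanSpace ℝ ι → PointConfig (EuclideanSpace ℝ ι × EuclideanSpace ℝ ι) → PointConfig (EuclideanSpace ℝ ι × EuclideanSpace ℝ ι) :=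
    fun a c => c ∪ PointConfig.ofFn fun _ : Fin 1 => a with hins
  have hH := measurableSet_hardCoreSet (d := ι) σ
  have hAH := hA.inter hH
  set Φ₁ := janossySeries M Λ (A ∩ hardCoreSet σ) with hΦ₁
  set Φ₀ := janossySeries M Λ (hardCoreSet σ) with hΦ₀
  set Φ₁' : ℝ := ∑' k : ℕ, z ^ k / k.factorial * (janossyCoeff M Λ (A ∩ hardCoreSet σ) (k + 1)).toReal with hΦ₁'
  set Φ₀' : ℝ := ∑' k : ℕ, z ^ k / k.factorial * (janossyCoeff M Λ (hardCoreSet σ) (k + 1)).toReal with hΦ₀'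
  have h1 : HasDerivAt Φ₁ Φ₁' z := hasDerivAt_janossySeries hb _ z
  have h0 : HasDerivAt Φ₀ Φ₀' z := hasDerivAt_janossySeries hb _ z
  have hΦ₀pos : 0 < Φ₀ z := lt_of_lt_of_le one_pos (one_le_janossySeries_hardCoreSet hb σ hz)
  have hdiv := h1.div h0 hΦ₀pos.ne'
  refine hdiv.congr_deriv ?_
  -- the probabilistic form of the two derivative series
  have hprob : ∀ {S : Set (PointConfig (EuclideanSpace ℝ ι × EuclideanSpace ℝ ι))}, MeasurableSet S → S ⊆ hardCoreSet σ →
      (P S).toReal = janossySeries M Λ S z / Φ₀ z := by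
    intro S hS hSH
    rw [hP, hsLocalSpec_empty_toReal_eq_div hz σ hΛ hb hS, inter_eq_left.2 hSH]
  have hmeas : ∀ {S : Set (PointConfig (EuclideanSpace ℝ ι × EuclideanSpace ℝ ι))}, MeasurableSet S → Measurable fun a => (P (ins a ⁻¹' S)).toReal :=
    fun hS => (measurable_hsLocalSpec_empty_preimage_union σ _ Λ hS).ennreal_toReal
  have hle1 : ∀ (S : Set (PointConfig (EuclideanSpace ℝ ι × EuclideanSpace ℝ ι))) a, ‖(P (ins a ⁻¹' S)).toReal‖ ≤ 1 := fun S a => by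
    rw [Real.norm_eq_abs, abs_of_nonneg ENNReal.toReal_nonneg]
    exact ENNReal.toReal_le_of_le_ofReal zero_le_one (by
      rw [ENNReal.ofReal_one]; exact hsLocalSpec_apply_le_one σ _ Λ ∅ _)
  have hintF : Integrable (fun a => (P (ins a ⁻¹' (A ∩ hardCoreSet σ))).toReal) π :=
    Integrable.of_bound (hmeas hAH).aestronglyMeasurable 1 (ae_of_all _ (hle1 _))
  have hintG : Integrable (fun a => (P (ins a ⁻¹' hardCoreSet σ)).toReal) π :=
    Integrable.of_bound (hmeas hH).aestronglyMeasurable 1 (ae_of_all _ (hle1 _))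
  have hF : ∫ a, (P (ins a ⁻¹' (A ∩ hardCoreSet σ))).toReal ∂π = Φ₁' / Φ₀ z := by
    rw [hΦ₁', tsum_janossyCoeff_succ_eq_integral hΛ hb hAH z, ← integral_div]
    refine integral_congr_ae (ae_of_all _ fun a => ?_)
    exact hprob (hAH.preimage (measurable_union_ofFn_const a)) (preimage_union_inter_hardCoreSet_subset σ a A)
  have hG : ∫ a, (P (ins a ⁻¹' hardCoreSet σ)).toReal ∂π = Φ₀' / Φ₀ z := by
    rw [hΦ₀', tsum_janossyCoeff_succ_eq_integral hΛ hb hH z, ← integral_div]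
    refine integral_congr_ae (ae_of_all _ fun a => ?_)
    have hsub : ins a ⁻¹' hardCoreSet σ ⊆ hardCoreSet σ := by
      have := preimage_union_inter_hardCoreSet_subset σ a univ
      rwa [univ_inter] at this
    exact hprob (hH.preimage (measurable_union_ofFn_const a)) hsub
  have hPA : (P A).toReal = Φ₁ z / Φ₀ z := by rw [hP, hsLocalSpec_empty_toReal_eq_div hz σ hΛ hb hA]
  rw [integral_sub hintF (hintG.const_mul _), integral_const_mul, hF, hG, hPA]
  field_simp

/-! ### The bound for the vacancy event of a ball -/

/-- The radial majorant `G_σ(x) = ∑ₙ 32·2⁻ⁿ 𝟙{‖x‖ < (n+1)σ}` of the derivative integrand. [folklore] -/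
theorem measurable_radialMajorant (σ : ℝ) :
    Measurable fun x : EuclideanSpace ℝ ι => ∑' n : ℕ, (Metric.ball (0 : EuclideanSpace ℝ ι) ((n + 1) * σ)).indicator
      (fun _ => ENNReal.ofReal (32 * (1 / 2) ^ n)) x :=
  Measurable.tsum fun _ => (measurable_const.indicator Metric.isOpen_ball.measurableSet)

/-- **The radial majorant is integrable over `ℝ³`**: `∫ G_σ ≤ ∑ₙ 32·2⁻ⁿ (2(n+1)σ)³ < ∞`. [folklore] -/
theorem lintegral_radialMajorant_lt_top {σ : ℝ} (hσ : 0 ≤ σ) :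
    ∫⁻ x : EuclideanSpace ℝ ι, ∑' n : ℕ, (Metric.ball (0 : EuclideanSpace ℝ ι) ((n + 1) * σ)).indicator
      (fun _ => ENNReal.ofReal (32 * (1 / 2) ^ n)) x < ∞ := by
  have hmeas : ∀ n : ℕ, MeasurableSet (Metric.ball (0 : EuclideanSpace ℝ ι) ((n + 1) * σ)) := fun n =>
    Metric.isOpen_ball.measurableSet
  rw [lintegral_tsum fun n => (measurable_const.indicator (hmeas n)).aemeasurable]
  simp_rw [lintegral_indicator_const (hmeas _)]
  have hle : ∀ n : ℕ, ENNReal.ofReal (32 * (1 / 2) ^ n) * volume (Metric.ball (0 : EuclideanSpace ℝ ι) ((n + 1) * σ)) ≤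
      ENNReal.ofReal (32 * (1 / 2) ^ n * (2 * ((n + 1) * σ)) ^ Fintype.card ι) := fun n =>
    calc ENNReal.ofReal (32 * (1 / 2) ^ n) * volume (Metric.ball (0 : EuclideanSpace ℝ ι) ((n + 1) * σ))
        ≤ ENNReal.ofReal (32 * (1 / 2) ^ n) * ENNReal.ofReal (2 * ((n + 1) * σ)) ^ Fintype.card ι :=
          mul_le_mul_right (volume_ball_le 0 _) _
      _ = ENNReal.ofReal (32 * (1 / 2) ^ n * (2 * ((n + 1) * σ)) ^ Fintype.card ι) := by
          rw [← ENNReal.ofReal_pow (by positivity), ← ENNReal.ofReal_mul (by positivity)]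
  refine lt_of_le_of_lt (ENNReal.tsum_le_tsum hle) ?_
  have hnn : ∀ n : ℕ, 0 ≤ 32 * (1 / 2 : ℝ) ^ n * (2 * ((n + 1) * σ)) ^ Fintype.card ι := fun n => by positivity
  have hsum : Summable fun n : ℕ => 32 * (1 / 2 : ℝ) ^ n * (2 * ((n + 1) * σ)) ^ Fintype.card ι := by
    have h3 := summable_pow_mul_geometric_of_norm_lt_one (Fintype.card ι) (show ‖(1 / 2 : ℝ)‖ < 1 by norm_num)
    have h3' : Summable fun n : ℕ => ((n + 1 : ℕ) : ℝ) ^ Fintype.card ι * (1 / 2 : ℝ) ^ (n + 1) :=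
      (summable_nat_add_iff 1).2 h3
    refine ((h3'.mul_left (32 * 2 * (2 * σ) ^ Fintype.card ι)).congr fun n => ?_)
    have h2 : (2 * (((n : ℝ) + 1) * σ)) ^ Fintype.card ι = (2 * σ) ^ Fintype.card ι * (((n + 1 : ℕ) : ℝ)) ^ Fintype.card ι := by
      rw [← mul_pow]; congr 1; push_cast; ring
    rw [h2, pow_succ]
    ring
  rw [← ENNReal.ofReal_tsum_of_nonneg hnn hsum]
  exact ENNReal.ofReal_lt_top

/-- A point of a nonnegative `ℝ≥0∞` series is at least any of its terms: the majorant dominates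
`32·2^{-⌊‖x‖/σ⌋}`. [folklore] -/
theorem ofReal_le_radialMajorant {σ : ℝ} (hσ : 0 < σ) (x : EuclideanSpace ℝ ι) :
    ENNReal.ofReal (32 * (1 / 2) ^ ⌊‖x‖ / σ⌋₊) ≤
      ∑' n : ℕ, (Metric.ball (0 : EuclideanSpace ℝ ι) ((n + 1) * σ)).indicator (fun _ => ENNReal.ofReal (32 * (1 / 2) ^ n)) x := by
  refine le_trans (le_of_eq ?_) (ENNReal.le_tsum ⌊‖x‖ / σ⌋₊)
  rw [indicator_of_mem]
  rw [Metric.mem_ball, dist_zero_right, ← div_lt_iff₀ hσ]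
  exact Nat.lt_floor_add_one _

variable {M}

/-- **The derivative integrand for the vacancy event of a ball is dominated by the radial
majorant.**  For `P = γ^z_{B(0,R)}(∅)`, `V = {N(B°_σ(0) × ℝ³) = 0}`, `0 ≤ z ≤ 1/(64σ³)` and
`a = (x, v)` with `‖x‖ < R`:
`|P((V ∩ HC)^a) - P(V) P(HC^a)| ≤ 32 · 2^{-⌊‖x‖/σ⌋}` — off the null event "`a` is a particle",
`(V ∩ HC)^a = V ∩ HC ∩ E_x` (or `∅` if `‖x‖ < σ`) and `HC^a = HC ∩ E_x`, and the covariance of the two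
vacancy events decays by `abs_measureReal_vacant_inter_vacant_sub_le (Classical.arbitrary ι)`.
[cite: MichelenPerkins2021, Thm 25 and §5] -/
theorem abs_integrand_vacant_le [Nonempty ι] (hσ : 0 < σ) {z : ℝ} (hz : 0 ≤ z) (hz1 : z ≤ 1 / (8 * (2 * σ) ^ Fintype.card ι))
    {R : ℝ} {a : EuclideanSpace ℝ ι × EuclideanSpace ℝ ι} (haR : ‖a.1‖ < R) :
    |(hsLocalSpec σ ((Real.toNNReal z) • ((volume : Measure (EuclideanSpace ℝ ι)).prod M)) (Metric.ball 0 R) ∅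
          ((fun c : PointConfig (EuclideanSpace ℝ ι × EuclideanSpace ℝ ι) => c ∪ PointConfig.ofFn fun _ : Fin 1 => a) ⁻¹'
            ({c : PointConfig (EuclideanSpace ℝ ι × EuclideanSpace ℝ ι) | c.count (window (Metric.ball (0 : EuclideanSpace ℝ ι) σ)) = 0} ∩ hardCoreSet σ))).toReal -
      (hsLocalSpec σ ((Real.toNNReal z) • ((volume : Measure (EuclideanSpace ℝ ι)).prod M)) (Metric.ball 0 R) ∅
          {c : PointConfig (EuclideanSpace ℝ ι × EuclideanSpace ℝ ι) | c.count (window (Metric.ball (0 : EuclideanSpace ℝ ι) σ)) = 0}).toReal *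
        (hsLocalSpec σ ((Real.toNNReal z) • ((volume : Measure (EuclideanSpace ℝ ι)).prod M)) (Metric.ball 0 R) ∅
          ((fun c : PointConfig (EuclideanSpace ℝ ι × EuclideanSpace ℝ ι) => c ∪ PointConfig.ofFn fun _ : Fin 1 => a) ⁻¹' hardCoreSet σ)).toReal| ≤
      32 * (1 / 2) ^ ⌊‖a.1‖ / σ⌋₊ := by
  set ν : Measure (EuclideanSpace ℝ ι × EuclideanSpace ℝ ι) := (Real.toNNReal z) • ((volume : Measure (EuclideanSpace ℝ ι)).prod M) with hν
  haveI : IsLocallyFiniteMeasure ν := by rw [hν]; infer_instance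
  set P := hsLocalSpec σ ν (Metric.ball 0 R) ∅ with hP
  set V : Set (PointConfig (EuclideanSpace ℝ ι × EuclideanSpace ℝ ι)) := {c | c.count (window (Metric.ball (0 : EuclideanSpace ℝ ι) σ)) = 0} with hV
  set E : Set (PointConfig (EuclideanSpace ℝ ι × EuclideanSpace ℝ ι)) := {c | c.count (window (Metric.ball a.1 σ)) = 0} with hE
  set N : Set (PointConfig (EuclideanSpace ℝ ι × EuclideanSpace ℝ ι)) := {c | c.count {a} = 0} with hN
  set ins : PointConfig (EuclideanSpace ℝ ι × EuclideanSpace ℝ ι) → PointConfig (EuclideanSpace ℝ ι × EuclideanSpace ℝ ι) := fun c => c ∪ PointConfig.ofFn fun _ : Fin 1 => a with hins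
  have hball : MeasurableSet (Metric.ball (0 : EuclideanSpace ℝ ι) R) := Metric.isOpen_ball.measurableSet
  have h0 : ∀ x, ν {x} = 0 := smul_prod_singleton z M
  have hm : ∀ t : ℝ, ν {y : EuclideanSpace ℝ ι × EuclideanSpace ℝ ι | y.1 (Classical.arbitrary ι) = t} = 0 := smul_prod_setOf_fst_apply (Classical.arbitrary ι) z M
  have hH := measurableSet_hardCoreSet (d := ι) σ
  have hHnull : P (hardCoreSet σ)ᶜ = 0 := hsLocalSpec_apply_compl_hardCoreSet σ ν _ ∅
  -- the two inserted events, off the null event `a ∈ c`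
  have hPH : P (ins ⁻¹' hardCoreSet σ) = P E := by
    rw [hP, hsLocalSpec_empty_apply_congr_off_atom h0 σ hball a (preimage_union_hardCoreSet_inter σ a),
      ← hP, inter_comm, measure_inter_conull hHnull]
  have hPVH_out : a ∉ window (Metric.ball (0 : EuclideanSpace ℝ ι) σ) → P (ins ⁻¹' (V ∩ hardCoreSet σ)) = P (V ∩ E) := by
    intro ha
    have hset : ins ⁻¹' (V ∩ hardCoreSet σ) ∩ N = (V ∩ E) ∩ hardCoreSet σ ∩ N := by
      rw [hV, preimage_union_setOf_count_eq_zero_inter_of_notMem ha, inter_assoc, ← hN,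
        preimage_union_hardCoreSet_inter σ a, ← hE]
      ext c; simp only [mem_inter_iff, mem_setOf_eq]; tauto
    rw [hP, hsLocalSpec_empty_apply_congr_off_atom h0 σ hball a hset, ← hP, measure_inter_conull hHnull]
  have hPVH_in : a ∈ window (Metric.ball (0 : EuclideanSpace ℝ ι) σ) → P (ins ⁻¹' (V ∩ hardCoreSet σ)) = 0 := by
    intro ha
    rw [hP, hsLocalSpec_empty_apply_congr_off_atom h0 σ hball a
      (preimage_union_setOf_count_eq_zero_inter_of_mem ha (hardCoreSet σ)), measure_empty]
  -- all probabilities are at most one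
  have hle1 : ∀ S, (P S).toReal ≤ 1 := fun S =>
    ENNReal.toReal_le_of_le_ofReal zero_le_one (by rw [ENNReal.ofReal_one]; exact hsLocalSpec_apply_le_one σ _ _ ∅ _)
  have hnn : ∀ S, 0 ≤ (P S).toReal := fun S => ENNReal.toReal_nonneg
  rw [hPH]
  -- the trivial bound `≤ 1`, enough for `⌊‖x‖/σ⌋ ≤ 4`
  have htriv : |(P (ins ⁻¹' (V ∩ hardCoreSet σ))).toReal - (P V).toReal * (P E).toReal| ≤ 1 := by
    rw [abs_le]
    constructor
    · have : (P V).toReal * (P E).toReal ≤ 1 := by nlinarith [hle1 V, hle1 E, hnn V, hnn E]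
      linarith [hnn (ins ⁻¹' (V ∩ hardCoreSet σ))]
    · nlinarith [hle1 (ins ⁻¹' (V ∩ hardCoreSet σ)), hnn V, hnn E]
  by_cases hn : ⌊‖a.1‖ / σ⌋₊ ≤ 4
  · refine htriv.trans ?_
    calc (1 : ℝ) ≤ 32 * (1 / 2) ^ 4 := by norm_num
      _ ≤ 32 * (1 / 2) ^ ⌊‖a.1‖ / σ⌋₊ :=
          mul_le_mul_of_nonneg_left (pow_le_pow_of_le_one (by norm_num) (by norm_num) hn) (by norm_num)
  -- far away: the covariance of the two vacancy events
  push Not at hn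
  obtain ⟨d, hd⟩ : ∃ d : ℕ, ⌊‖a.1‖ / σ⌋₊ = d + 4 := ⟨⌊‖a.1‖ / σ⌋₊ - 4, by omega⟩
  have hfloor : (⌊‖a.1‖ / σ⌋₊ : ℝ) * σ ≤ ‖a.1‖ := by
    have := Nat.floor_le (div_nonneg (norm_nonneg a.1) hσ.le)
    rwa [le_div_iff₀ hσ] at this
  have hdist : ((d : ℝ) + 4) * σ ≤ ‖a.1‖ := by
    have : ((d + 4 : ℕ) : ℝ) = (d : ℝ) + 4 := by push_cast; ring
    rw [← this, ← hd]; exact hfloor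
  have hout : a ∉ window (Metric.ball (0 : EuclideanSpace ℝ ι) σ) := by
    rw [mem_window, Metric.mem_ball, dist_zero_right, not_lt]
    nlinarith [hσ, (Nat.cast_nonneg d : (0 : ℝ) ≤ d)]
  rw [hPVH_out hout]
  -- the constants of the covariance bound
  have hκ0 : (0 : ℝ) ≤ z * (2 * σ) ^ Fintype.card ι := by positivity
  have hκ : ∀ q : EuclideanSpace ℝ ι, ν (window (Metric.ball q σ)) ≤ ENNReal.ofReal (z * (2 * σ) ^ Fintype.card ι) := fun q => by
    rw [hν, smul_prod_window, measure_univ, mul_one, show z * (2 * σ) ^ Fintype.card ι = z * (2 * σ) ^ Fintype.card ι by ring,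
      ENNReal.ofReal_mul hz, ENNReal.ofReal_pow (by positivity)]
    gcongr
    exact volume_ball_le q σ
  have hfin : ∀ R : ℝ, ν (window (Metric.ball (0 : EuclideanSpace ℝ ι) R)) ≠ ∞ := fun R => by
    rw [hν, smul_prod_window, measure_univ, mul_one]
    exact ENNReal.mul_ne_top ENNReal.ofReal_ne_top Metric.isBounded_ball.measure_lt_top.ne
  have hxR : ‖a.1‖ - σ ≤ R := by linarith
  have hcov := abs_measureReal_vacant_inter_vacant_sub_le (Classical.arbitrary ι) ν hσ h0 hm hκ0 hκ hfin hdist hxR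
  simp only [measureReal_def] at hcov
  rw [← hP, ← hV, ← hE] at hcov
  refine hcov.trans ?_
  -- `2 · (2 ν(W) e^{ν(W)} (2κ)^d) · P(E) ≤ 32 · 2^{-(d+4)}` for `κ = 8zσ³ ≤ 1/8`
  have hκ8 : z * (2 * σ) ^ Fintype.card ι ≤ 1 / 8 := by
    have hσ3 : 0 < (2 * σ) ^ Fintype.card ι := by positivity
    calc z * (2 * σ) ^ Fintype.card ι ≤ (1 / (8 * (2 * σ) ^ Fintype.card ι)) * (2 * σ) ^ Fintype.card ι := by gcongr
      _ = 1 / 8 := by field_simp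
  have hνW : (ν (window (Metric.ball (0 : EuclideanSpace ℝ ι) σ))).toReal ≤ 1 / 8 :=
    (ENNReal.toReal_mono ENNReal.ofReal_ne_top (hκ 0)).trans (by rw [ENNReal.toReal_ofReal hκ0]; exact hκ8)
  have hνW0 : 0 ≤ (ν (window (Metric.ball (0 : EuclideanSpace ℝ ι) σ))).toReal := ENNReal.toReal_nonneg
  have hexp : Real.exp ((ν (window (Metric.ball (0 : EuclideanSpace ℝ ι) σ))).toReal) ≤ 3 := by
    have h1 : Real.exp ((ν (window (Metric.ball (0 : EuclideanSpace ℝ ι) σ))).toReal) ≤ Real.exp 1 :=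
      Real.exp_le_exp.2 (by linarith)
    have h2 := Real.exp_one_lt_d9
    linarith
  have hpow : (2 * (z * (2 * σ) ^ Fintype.card ι)) ^ d ≤ (1 / 2 : ℝ) ^ d :=
    pow_le_pow_left₀ (by positivity) (by linarith) d
  have hPE : (P E).toReal ≤ 1 := hle1 E
  have hPE0 : 0 ≤ (P E).toReal := hnn E
  rw [hd]
  calc 2 * (2 * (ν (window (Metric.ball (0 : EuclideanSpace ℝ ι) σ))).toReal *
          Real.exp ((ν (window (Metric.ball (0 : EuclideanSpace ℝ ι) σ))).toReal) * (2 * (z * (2 * σ) ^ Fintype.card ι)) ^ d) * (P E).toReal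
      ≤ 2 * (2 * (1 / 8) * 3 * (1 / 2 : ℝ) ^ d) * 1 := by
        gcongr
    _ ≤ 32 * (1 / 2 : ℝ) ^ (d + 4) := by
        rw [pow_add]; nlinarith [pow_pos (show (0 : ℝ) < 1 / 2 by norm_num) d]

/-- **Uniform bound on the activity derivative of the free vacancy probability**:
for `0 ≤ z ≤ 1/(64σ³)` and every volume `B(0,R)`, the derivative of
`z ↦ Φ_{V∩HC}(z)/Φ_{HC}(z) = γ^z_{B(0,R)}(∅)(V)` is bounded by `L_σ = ∫_{ℝ³} G_σ < ∞`,
independently of `R`. [cite: Ruelle1969, §4.2, Thm 4.2.3] -/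
theorem norm_deriv_vacant_le [Nonempty ι] (hσ : 0 < σ) {z : ℝ} (hz : 0 ≤ z) (hz1 : z ≤ 1 / (8 * (2 * σ) ^ Fintype.card ι)) (R : ℝ) :
    ‖∫ a, ((hsLocalSpec σ ((Real.toNNReal z) • ((volume : Measure (EuclideanSpace ℝ ι)).prod M)) (Metric.ball 0 R) ∅
          ((fun c : PointConfig (EuclideanSpace ℝ ι × EuclideanSpace ℝ ι) => c ∪ PointConfig.ofFn fun _ : Fin 1 => a) ⁻¹'
            ({c : PointConfig (EuclideanSpace ℝ ι × EuclideanSpace ℝ ι) | c.count (window (Metric.ball (0 : EuclideanSpace ℝ ι) σ)) = 0} ∩ hardCoreSet σ))).toReal -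
        (hsLocalSpec σ ((Real.toNNReal z) • ((volume : Measure (EuclideanSpace ℝ ι)).prod M)) (Metric.ball 0 R) ∅
          {c : PointConfig (EuclideanSpace ℝ ι × EuclideanSpace ℝ ι) | c.count (window (Metric.ball (0 : EuclideanSpace ℝ ι) σ)) = 0}).toReal *
          (hsLocalSpec σ ((Real.toNNReal z) • ((volume : Measure (EuclideanSpace ℝ ι)).prod M)) (Metric.ball 0 R) ∅
            ((fun c : PointConfig (EuclideanSpace ℝ ι × EuclideanSpace ℝ ι) => c ∪ PointConfig.ofFn fun _ : Fin 1 => a) ⁻¹' hardCoreSet σ)).toReal)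
        ∂(((volume : Measure (EuclideanSpace ℝ ι)).restrict (Metric.ball 0 R)).prod M)‖ ≤
      (∫⁻ x : EuclideanSpace ℝ ι, ∑' n : ℕ, (Metric.ball (0 : EuclideanSpace ℝ ι) ((n + 1) * σ)).indicator
        (fun _ => ENNReal.ofReal (32 * (1 / 2) ^ n)) x).toReal := by
  set π : Measure (EuclideanSpace ℝ ι × EuclideanSpace ℝ ι) := ((volume : Measure (EuclideanSpace ℝ ι)).restrict (Metric.ball 0 R)).prod M with hπ
  set G : EuclideanSpace ℝ ι → ℝ≥0∞ := fun x => ∑' n : ℕ, (Metric.ball (0 : EuclideanSpace ℝ ι) ((n + 1) * σ)).indicator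
    (fun _ => ENNReal.ofReal (32 * (1 / 2) ^ n)) x with hG
  have hGm : Measurable G := measurable_radialMajorant σ
  refine (norm_integral_le_lintegral_norm _).trans (ENNReal.toReal_mono (lintegral_radialMajorant_lt_top hσ.le).ne ?_)
  -- a.e. `‖x‖ < R`, where the integrand is dominated by `G(x)`
  have hae : ∀ᵐ a ∂π, a ∈ window (Metric.ball (0 : EuclideanSpace ℝ ι) R) := ae_mem_window Metric.isOpen_ball.measurableSet
  calc ∫⁻ a, ENNReal.ofReal ‖_‖ ∂π ≤ ∫⁻ a, G a.1 ∂π := by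
        refine lintegral_mono_ae (hae.mono fun a ha => ?_)
        rw [mem_window, Metric.mem_ball, dist_zero_right] at ha
        rw [Real.norm_eq_abs]
        exact (ENNReal.ofReal_le_ofReal (abs_integrand_vacant_le hσ hz hz1 ha)).trans
          (ofReal_le_radialMajorant hσ a.1)
    _ = ∫⁻ x in Metric.ball (0 : EuclideanSpace ℝ ι) R, ∫⁻ _v, G x ∂M := lintegral_prod _ (hGm.comp measurable_fst).aemeasurable
    _ = ∫⁻ x in Metric.ball (0 : EuclideanSpace ℝ ι) R, G x := by
        refine lintegral_congr fun x => ?_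
        rw [lintegral_const, measure_univ, mul_one]
    _ ≤ ∫⁻ x, G x := lintegral_mono' Measure.restrict_le_self le_rfl

/-- **The free finite-volume vacancy probabilities are Lipschitz in the activity, uniformly in the
volume**: for `0 ≤ z, z' ≤ 1/(64σ³)` and every `R`,
`|γ^z_{B(0,R)}(∅)(V) - γ^{z'}_{B(0,R)}(∅)(V)| ≤ L_σ |z - z'|` with `V = {N(B°_σ(0) × ℝ³) = 0}` and
`L_σ = ∫_{ℝ³} G_σ` independent of `R` (mean value theorem with `norm_deriv_vacant_le (Classical.arbitrary ι)`).
[cite: Ruelle1969, §4.2, Thm 4.2.3] -/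
theorem abs_hsLocalSpec_empty_vacant_sub_le [Nonempty ι] (hσ : 0 < σ) {z z' : ℝ} (hz : 0 ≤ z) (hz1 : z ≤ 1 / (8 * (2 * σ) ^ Fintype.card ι))
    (hz' : 0 ≤ z') (hz'1 : z' ≤ 1 / (8 * (2 * σ) ^ Fintype.card ι)) (R : ℝ) :
    |(hsLocalSpec σ ((Real.toNNReal z) • ((volume : Measure (EuclideanSpace ℝ ι)).prod M)) (Metric.ball 0 R) ∅
          {c : PointConfig (EuclideanSpace ℝ ι × EuclideanSpace ℝ ι) | c.count (window (Metric.ball (0 : EuclideanSpace ℝ ι) σ)) = 0}).toReal -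
      (hsLocalSpec σ ((Real.toNNReal z') • ((volume : Measure (EuclideanSpace ℝ ι)).prod M)) (Metric.ball 0 R) ∅
          {c : PointConfig (EuclideanSpace ℝ ι × EuclideanSpace ℝ ι) | c.count (window (Metric.ball (0 : EuclideanSpace ℝ ι) σ)) = 0}).toReal| ≤
      (∫⁻ x : EuclideanSpace ℝ ι, ∑' n : ℕ, (Metric.ball (0 : EuclideanSpace ℝ ι) ((n + 1) * σ)).indicator
        (fun _ => ENNReal.ofReal (32 * (1 / 2) ^ n)) x).toReal * |z - z'| := by
  set V : Set (PointConfig (EuclideanSpace ℝ ι × EuclideanSpace ℝ ι)) := {c | c.count (window (Metric.ball (0 : EuclideanSpace ℝ ι) σ)) = 0} with hV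
  have hVm : MeasurableSet V := measurableSet_count_eq_zero (measurableSet_window_ball σ ((0 : EuclideanSpace ℝ ι), (0 : EuclideanSpace ℝ ι)))
  have hball : MeasurableSet (Metric.ball (0 : EuclideanSpace ℝ ι) R) := Metric.isOpen_ball.measurableSet
  have hb : Bornology.IsBounded (Metric.ball (0 : EuclideanSpace ℝ ι) R) := Metric.isBounded_ball
  set f : ℝ → ℝ := fun y => janossySeries M (Metric.ball 0 R) (V ∩ hardCoreSet σ) y /
    janossySeries M (Metric.ball 0 R) (hardCoreSet σ) y with hf
  have hderiv : ∀ y ∈ Icc (0 : ℝ) (1 / (8 * (2 * σ) ^ Fintype.card ι)), HasDerivWithinAt f _ (Icc (0 : ℝ) (1 / (8 * (2 * σ) ^ Fintype.card ι))) y :=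
    fun y hy => (hasDerivAt_div_janossySeries M σ hball hb hVm hy.1).hasDerivWithinAt
  have h := (convex_Icc (0 : ℝ) (1 / (8 * (2 * σ) ^ Fintype.card ι))).norm_image_sub_le_of_norm_hasDerivWithin_le hderiv
    (fun y hy => norm_deriv_vacant_le hσ hy.1 hy.2 R) ⟨hz', hz'1⟩ ⟨hz, hz1⟩
  rw [hf] at h
  simp only at h
  rwa [← hsLocalSpec_empty_toReal_eq_div hz σ hball hb hVm, ← hsLocalSpec_empty_toReal_eq_div hz' σ hball hb hVm,
    Real.norm_eq_abs, Real.norm_eq_abs] at h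

end ActivityDerivative

end HardSphereDLR

end Literature.MathematicalPhysics.KineticTheory
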